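import Mathlib.Tactic.LinearCombination
import Summits.MatrixMultiplication.OmegaCensus.DicyclicN1Chars
import Summits.MatrixMultiplication.OmegaCensus.DihedralLikeTiling
import HarnessLib

/-!
# Class N1 of the dicyclic law, part 2: the two `T`-differences agree up to sign in `A/⟨c₀⟩`

ω-census `pub-omega`, family (b3), seat pub-omega-group gen 12.  Framing: lottery ticket; floor = certified bounds/negative
ranges.  VALUE: kernel theorem for the structure theory of TPP triples in dicyclic-type groups; NOT progress on ω.

Additive core, stated over a finite abelian group `A` with `π : A →+ B` onto, `ker π = {0, c₀}` (`c₀ ≠ 0`), `B` a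
`2`-group.  The data of an N1-class dicyclic-law triple (`|S₀| = |S₁| = 1`, `T_j = t_j + {0, e_j}`, parts `U₀`, `U₁` of `U`
with `|U₀| = |U₁| + 2`, `|A| = 4|U₀| + 2|U₁|`; `DicyclicN1Law.lean` does the bookkeeping) consists of the pieces
`U_l + α ⊔ U_l + (α + e_j)` and:

* (T1, vertex `000` exact) `A = [U₀+α₁ ⊔ U₀+α₁+e₀] ⊔ [U₁+α₂ ⊔ U₁+α₂+e₀] ⊔ [U₀+α₃ ⊔ U₀+α₃+e₁]`;
* (T2, vertex `010` exact) `A = [U₀+β₁ ⊔ U₀+β₁+e₁] ⊔ [U₁+β₂ ⊔ U₁+β₂+e₁] ⊔ [U₀+β₃ ⊔ U₀+β₃+e₀]`,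
  with `β₁ − β₂ = α₁ − α₂` and `β₃ − β₂ = α₃ − α₂ + e₁ − e₀ + c₀`;
* (Per) `U₀ ⊔ (U₀+e₁)` and `U₁ ⊔ (U₁+e₁)` are `c₀`-periodic (all boxes are, the four vertices `(i,j,0)` being exact);
* (F, the packing at vertex `001` compared with T1) `U₁+y ⊔ U₁+y+e₁ ⊆ U₀ ⊔ U₀+e₁`.

**Theorem (`n1_dichotomy`).** Then `π e₀ = 0`, `π e₁ = 0`, `π e₁ = π e₀` or `π e₁ = −π e₀`.

*Proof.* For a character `χ` of `B` put `ψ = χ ∘ π`, `Y = ∑_{U₀} ψ`, `Q = ∑_{U₁} ψ`.  Eliminating between the character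
forms of (T1), (T2) gives `Y·(1 − ψ(e₁−e₀))(1 − ψ(e₁+e₀)) = 0` and the same for `Q` (`n1_charsum_vanish`).  By (F) and
(Per) the uncovered set `E = (U₀ ⊔ U₀+e₁) ∖ (U₁+y ⊔ U₁+y+e₁)` is `{p, p+c₀, p', p'+c₀}`, and its character sum
`(1 + ψ e₁)(Y − ψ(y) Q)` yields `(χ p̄ + χ p̄')(1 − χ ū)(1 − χ v̄) = 0` and, for `χ(ē₁) = −1`, `χ p̄ + χ p̄' = 0`; the `±` lemma
`eq_or_eq_neg_of_two_point` (`DicyclicN1Chars.lean`) concludes.  (The `2`-group hypothesis enters only there.)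
-/

namespace Summit.MatrixMultiplication.OmegaCensus

open Finset

section N1Dichotomy

variable {A : Type} [AddCommGroup A] [Fintype A] [DecidableEq A] {B : Type} [AddCommGroup B] [Fintype B]
  [DecidableEq B]

omit [Fintype A] [Fintype B] [DecidableEq B] in
/-- A `c₀`-periodic set of size `4` (`c₀ ≠ 0`, `2c₀ = 0`) is `{p, p + c₀} ⊔ {p', p' + c₀}`. [folklore] -/
theorem periodic_card_four {E : Finset A} {c₀ : A} (hc₀ : c₀ ≠ 0) (h2c : c₀ + c₀ = 0)
    (hper : E.image (· + c₀) = E) (hcard : E.card = 4) :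
    ∃ p p' : A, p ∈ E ∧ p' ∈ E ∧ p' ≠ p ∧ p' ≠ p + c₀ ∧
      E = ({p, p + c₀} : Finset A) ∪ ({p', p' + c₀} : Finset A) ∧
      Disjoint ({p, p + c₀} : Finset A) ({p', p' + c₀} : Finset A) := by
  have hmem : ∀ x ∈ E, x + c₀ ∈ E := fun x hx => by rw [← hper]; exact mem_image_of_mem _ hx
  obtain ⟨p, hp⟩ : E.Nonempty := card_pos.1 (by rw [hcard]; norm_num)
  have hpc : p + c₀ ∈ E := hmem p hp
  have hne : p ≠ p + c₀ := fun h => hc₀ (left_eq_add.1 h)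
  set E' := E \ {p, p + c₀} with hE'
  have hsub : ({p, p + c₀} : Finset A) ⊆ E := by
    intro x hx; rcases mem_insert.1 hx with rfl | hx
    · exact hp
    · rw [mem_singleton.1 hx]; exact hpc
  have cE' : E'.card = 2 := by rw [hE', card_sdiff_of_subset hsub, card_pair hne, hcard]
  obtain ⟨p', hp'⟩ : E'.Nonempty := card_pos.1 (by rw [cE']; norm_num)
  obtain ⟨hp'E, hp'n⟩ := mem_sdiff.1 hp'
  rw [mem_insert, mem_singleton, not_or] at hp'n
  have hp'c : p' + c₀ ∈ E' := by
    refine mem_sdiff.2 ⟨hmem p' hp'E, ?_⟩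
    rw [mem_insert, mem_singleton, not_or]
    constructor
    · intro h; apply hp'n.2
      calc p' = p' + c₀ + c₀ := by rw [add_assoc, h2c, add_zero]
        _ = p + c₀ := by rw [h]
    · intro h; exact hp'n.1 (add_right_cancel h)
  have hne' : p' ≠ p' + c₀ := fun h => hc₀ (left_eq_add.1 h)
  have hE'eq : E' = {p', p' + c₀} := by
    symm
    apply eq_of_subset_of_card_le
    · intro x hx; rcases mem_insert.1 hx with rfl | hx
      · exact hp'
      · rw [mem_singleton.1 hx]; exact hp'c
    · rw [cE', card_pair hne']
  refine ⟨p, p', hp, hp'E, hp'n.1, hp'n.2, ?_, ?_⟩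
  · rw [← hE'eq, hE', union_sdiff_of_subset hsub]
  · rw [← hE'eq, hE']; exact disjoint_sdiff

omit [Fintype A] [DecidableEq A] [Fintype B] [DecidableEq B] in
/-- The pull-back `χ ∘ π` of a non-trivial character along a surjection is non-trivial. [folklore] -/
theorem compAddMonoidHom_ne_zero (π : A →+ B) (hπ : Function.Surjective π) {χ : AddChar B ℂ} (hχ : χ ≠ 0) :
    χ.compAddMonoidHom π ≠ 0 := by
  intro h
  apply hχ
  refine DFunLike.ext χ 0 fun b => ?_
  obtain ⟨a, rfl⟩ := hπ b
  have := DFunLike.congr_fun h a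
  rwa [AddChar.compAddMonoidHom_apply, AddChar.zero_apply] at this

omit [Fintype B] [DecidableEq B] in
/-- **Character sums of `U₀`, `U₁` vanish off two subgroups.**  Under (T1), (T2) (pairwise disjointness of the three
pieces, the cardinality equation) with the shift relations, for every character `χ` of `B` and `ψ = χ ∘ π`:
`(∑_{U₀} ψ)·(1 − ψ(e₁ − e₀))·(1 − ψ(e₁ + e₀)) = 0` and the same for `U₁`. [folklore] -/
theorem n1_charsum_vanish (π : A →+ B) (hπ : Function.Surjective π) {c₀ : A} (hπc : π c₀ = 0)
    {U₀ U₁ : Finset A} {e₀ e₁ α₁ α₂ α₃ β₁ β₂ β₃ : A}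
    (hU₀e₀ : Disjoint U₀ (U₀.image (· + e₀))) (hU₀e₁ : Disjoint U₀ (U₀.image (· + e₁)))
    (hU₁e₀ : Disjoint U₁ (U₁.image (· + e₀))) (hU₁e₁ : Disjoint U₁ (U₁.image (· + e₁)))
    (hA : Fintype.card A = 4 * U₀.card + 2 * U₁.card)
    (h12 : Disjoint (U₀.image (· + α₁) ∪ U₀.image (· + (α₁ + e₀))) (U₁.image (· + α₂) ∪ U₁.image (· + (α₂ + e₀))))
    (h13 : Disjoint (U₀.image (· + α₁) ∪ U₀.image (· + (α₁ + e₀))) (U₀.image (· + α₃) ∪ U₀.image (· + (α₃ + e₁))))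
    (h23 : Disjoint (U₁.image (· + α₂) ∪ U₁.image (· + (α₂ + e₀))) (U₀.image (· + α₃) ∪ U₀.image (· + (α₃ + e₁))))
    (k12 : Disjoint (U₀.image (· + β₁) ∪ U₀.image (· + (β₁ + e₁))) (U₁.image (· + β₂) ∪ U₁.image (· + (β₂ + e₁))))
    (k13 : Disjoint (U₀.image (· + β₁) ∪ U₀.image (· + (β₁ + e₁))) (U₀.image (· + β₃) ∪ U₀.image (· + (β₃ + e₀))))
    (k23 : Disjoint (U₁.image (· + β₂) ∪ U₁.image (· + (β₂ + e₁))) (U₀.image (· + β₃) ∪ U₀.image (· + (β₃ + e₀))))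
    (hrel₁ : β₁ - β₂ = α₁ - α₂) (hrel₂ : β₃ - β₂ = α₃ - α₂ + e₁ - e₀ + c₀) (χ : AddChar B ℂ) :
    (∑ x ∈ U₀, χ.compAddMonoidHom π x) *
        ((1 - χ.compAddMonoidHom π (e₁ - e₀)) * (1 - χ.compAddMonoidHom π (e₁ + e₀))) = 0 ∧
    (∑ x ∈ U₁, χ.compAddMonoidHom π x) *
        ((1 - χ.compAddMonoidHom π (e₁ - e₀)) * (1 - χ.compAddMonoidHom π (e₁ + e₀))) = 0 := by
  set ψ := χ.compAddMonoidHom π with hψdef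
  by_cases hχ : χ = 0
  · subst hχ
    have h1 : ψ (e₁ - e₀) = 1 := by rw [hψdef, AddChar.compAddMonoidHom_apply, AddChar.zero_apply]
    simp [h1]
  have hψ : ψ ≠ 0 := compAddMonoidHom_ne_zero π hπ hχ
  have hψc : ψ c₀ = 1 := by rw [hψdef, AddChar.compAddMonoidHom_apply, hπc, AddChar.map_zero_eq_one]
  -- disjointness inside the pieces
  have d₁ : Disjoint (U₀.image (· + α₁)) (U₀.image (· + (α₁ + e₀))) := disjoint_shift hU₀e₀ α₁
  have d₂ : Disjoint (U₁.image (· + α₂)) (U₁.image (· + (α₂ + e₀))) := disjoint_shift hU₁e₀ α₂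
  have d₃ : Disjoint (U₀.image (· + α₃)) (U₀.image (· + (α₃ + e₁))) := disjoint_shift hU₀e₁ α₃
  have d₁' : Disjoint (U₀.image (· + β₁)) (U₀.image (· + (β₁ + e₁))) := disjoint_shift hU₀e₁ β₁
  have d₂' : Disjoint (U₁.image (· + β₂)) (U₁.image (· + (β₂ + e₁))) := disjoint_shift hU₁e₁ β₂
  have d₃' : Disjoint (U₀.image (· + β₃)) (U₀.image (· + (β₃ + e₀))) := disjoint_shift hU₀e₀ β₃
  -- (T1), (T2) as character identities
  have E1 := charsum_tiling' ψ hψ h12 h13 h23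
    (by rw [card_two_translates d₁, card_two_translates d₂, card_two_translates d₃]; omega)
  have E2 := charsum_tiling' ψ hψ k12 k13 k23
    (by rw [card_two_translates d₁', card_two_translates d₂', card_two_translates d₃']; omega)
  rw [charsum_two_translates ψ d₁, charsum_two_translates ψ d₂, charsum_two_translates ψ d₃] at E1
  rw [charsum_two_translates ψ d₁', charsum_two_translates ψ d₂', charsum_two_translates ψ d₃'] at E2
  -- abbreviations
  set Y := ∑ x ∈ U₀, ψ x with hY
  set Q := ∑ x ∈ U₁, ψ x with hQ
  have ea₁ : ψ (α₁ + e₀) = ψ α₁ * ψ e₀ := AddChar.map_add_eq_mul ψ _ _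
  have ea₂ : ψ (α₂ + e₀) = ψ α₂ * ψ e₀ := AddChar.map_add_eq_mul ψ _ _
  have ea₃ : ψ (α₃ + e₁) = ψ α₃ * ψ e₁ := AddChar.map_add_eq_mul ψ _ _
  have eb₁ : ψ (β₁ + e₁) = ψ β₁ * ψ e₁ := AddChar.map_add_eq_mul ψ _ _
  have eb₂ : ψ (β₂ + e₁) = ψ β₂ * ψ e₁ := AddChar.map_add_eq_mul ψ _ _
  have eb₃ : ψ (β₃ + e₀) = ψ β₃ * ψ e₀ := AddChar.map_add_eq_mul ψ _ _
  rw [ea₁, ea₂, ea₃] at E1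
  rw [eb₁, eb₂, eb₃] at E2
  -- the shift relations
  have R1 : ψ β₁ * ψ α₂ = ψ β₂ * ψ α₁ := by
    rw [← AddChar.map_add_eq_mul, ← AddChar.map_add_eq_mul]
    congr 1
    have h := hrel₁
    rw [sub_eq_sub_iff_add_eq_add] at h
    rw [h, add_comm]
  have R2 : ψ β₃ * ψ α₂ * ψ e₀ = ψ β₂ * ψ α₃ * ψ e₁ := by
    have h : β₃ + α₂ + e₀ = β₂ + α₃ + e₁ + c₀ := by
      have h' := hrel₂
      rw [sub_eq_iff_eq_add] at h'
      rw [h']; abel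
    calc ψ β₃ * ψ α₂ * ψ e₀ = ψ (β₃ + α₂ + e₀) := by rw [AddChar.map_add_eq_mul, AddChar.map_add_eq_mul]
      _ = ψ (β₂ + α₃ + e₁ + c₀) := by rw [h]
      _ = ψ β₂ * ψ α₃ * ψ e₁ := by
        rw [AddChar.map_add_eq_mul, AddChar.map_add_eq_mul, AddChar.map_add_eq_mul, hψc, mul_one]
  have hne := addChar_apply_ne_zero ψ
  have haa : ψ e₀ * ψ (-e₀) = 1 := addChar_mul_neg ψ e₀
  -- Step 1: `Y (a₀ − a₁)(1 − a₀a₁) = 0`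
  have HY0 : Y * (ψ e₀ - ψ e₁) * (1 - ψ e₀ * ψ e₁) * (ψ α₃ * ψ β₂) = 0 := by
    linear_combination (ψ e₀ * (1 + ψ e₁) * ψ β₂) * E1 - ((1 + ψ e₀) * ψ α₂ * ψ e₀) * E2
      + (Y * ψ e₀ * (1 + ψ e₀) * (1 + ψ e₁)) * R1 + (Y * (1 + ψ e₀) ^ 2) * R2
  have HY : Y * (ψ e₀ - ψ e₁) * (1 - ψ e₀ * ψ e₁) = 0 := by
    rcases mul_eq_zero.1 HY0 with h | h
    · exact h
    · exfalso; rcases mul_eq_zero.1 h with h | h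
      · exact hne _ h
      · exact hne _ h
  have eu : ψ (e₁ - e₀) = ψ e₁ * ψ (-e₀) := by rw [sub_eq_add_neg, AddChar.map_add_eq_mul]
  have ev : ψ (e₁ + e₀) = ψ e₁ * ψ e₀ := AddChar.map_add_eq_mul ψ _ _
  have HYΦ : Y * ((1 - ψ (e₁ - e₀)) * (1 - ψ (e₁ + e₀))) = 0 := by
    rw [eu, ev]
    linear_combination ψ (-e₀) * HY - Y * (1 - ψ e₁ * ψ e₀) * haa
  -- Step 2: `Q`
  have g0 : ψ α₂ * ψ β₂ ≠ 0 := mul_ne_zero (hne _) (hne _)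
  have HQ1 : Q * (1 + ψ e₀) * ((ψ e₀ - ψ e₁) * (1 - ψ e₀ * ψ e₁)) = 0 := by
    have h : ψ β₂ * (ψ α₂ * (1 + ψ e₀) * Q) =
        -(ψ α₁ * ψ β₂ * (1 + ψ e₀) + ψ α₃ * ψ β₂ * (1 + ψ e₁)) * Y := by
      linear_combination ψ β₂ * E1
    have h2 : ψ β₂ * (ψ α₂ * (1 + ψ e₀) * Q) * ((ψ e₀ - ψ e₁) * (1 - ψ e₀ * ψ e₁)) = 0 := by
      rw [h]; linear_combination -(ψ α₁ * ψ β₂ * (1 + ψ e₀) + ψ α₃ * ψ β₂ * (1 + ψ e₁)) * HY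
    have h3 : (ψ α₂ * ψ β₂) * (Q * (1 + ψ e₀) * ((ψ e₀ - ψ e₁) * (1 - ψ e₀ * ψ e₁))) = 0 := by
      linear_combination h2
    exact (mul_eq_zero.1 h3).resolve_left g0
  have HQ2 : Q * (1 + ψ e₁) * ((ψ e₀ - ψ e₁) * (1 - ψ e₀ * ψ e₁)) = 0 := by
    have h : ψ α₂ * (ψ β₂ * (1 + ψ e₁) * Q) =
        -(ψ β₁ * ψ α₂ * (1 + ψ e₁) + ψ β₃ * ψ α₂ * (1 + ψ e₀)) * Y := by
      linear_combination ψ α₂ * E2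
    have h2 : ψ α₂ * (ψ β₂ * (1 + ψ e₁) * Q) * ((ψ e₀ - ψ e₁) * (1 - ψ e₀ * ψ e₁)) = 0 := by
      rw [h]; linear_combination -(ψ β₁ * ψ α₂ * (1 + ψ e₁) + ψ β₃ * ψ α₂ * (1 + ψ e₀)) * HY
    have h3 : (ψ α₂ * ψ β₂) * (Q * (1 + ψ e₁) * ((ψ e₀ - ψ e₁) * (1 - ψ e₀ * ψ e₁))) = 0 := by
      linear_combination h2
    exact (mul_eq_zero.1 h3).resolve_left g0
  have HQ : Q * ((ψ e₀ - ψ e₁) * (1 - ψ e₀ * ψ e₁)) = 0 := by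
    by_cases hb0 : 1 + ψ e₀ = 0
    · by_cases hb1 : 1 + ψ e₁ = 0
      · have ha : ψ e₀ = -1 := by linear_combination hb0
        have hb : ψ e₁ = -1 := by linear_combination hb1
        rw [ha, hb]; ring
      · have h := HQ2
        rw [mul_assoc, mul_comm (1 + ψ e₁), ← mul_assoc] at h
        exact (mul_eq_zero.1 h).resolve_right hb1
    · have h := HQ1
      rw [mul_assoc, mul_comm (1 + ψ e₀), ← mul_assoc] at h
      exact (mul_eq_zero.1 h).resolve_right hb0
  have HQΦ : Q * ((1 - ψ (e₁ - e₀)) * (1 - ψ (e₁ + e₀))) = 0 := by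
    rw [eu, ev]
    linear_combination ψ (-e₀) * HQ - Q * (1 - ψ e₁ * ψ e₀) * haa
  exact ⟨HYΦ, HQΦ⟩

/-- **The two `T`-differences agree up to sign modulo `c₀`** (see the module docstring for the hypotheses).
[folklore] -/
theorem n1_dichotomy (π : A →+ B) (hπ : Function.Surjective π) {c₀ : A}
    (hker : ∀ a : A, π a = 0 ↔ a = 0 ∨ a = c₀) (hc₀ : c₀ ≠ 0) {m : ℕ} (hB : ∀ b : B, (2 ^ m) • b = 0)
    {U₀ U₁ : Finset A} {e₀ e₁ α₁ α₂ α₃ β₁ β₂ β₃ y : A}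
    (hU₀e₀ : Disjoint U₀ (U₀.image (· + e₀))) (hU₀e₁ : Disjoint U₀ (U₀.image (· + e₁)))
    (hU₁e₀ : Disjoint U₁ (U₁.image (· + e₀))) (hU₁e₁ : Disjoint U₁ (U₁.image (· + e₁)))
    (hcard : U₀.card = U₁.card + 2) (hA : Fintype.card A = 4 * U₀.card + 2 * U₁.card)
    (h12 : Disjoint (U₀.image (· + α₁) ∪ U₀.image (· + (α₁ + e₀))) (U₁.image (· + α₂) ∪ U₁.image (· + (α₂ + e₀))))
    (h13 : Disjoint (U₀.image (· + α₁) ∪ U₀.image (· + (α₁ + e₀))) (U₀.image (· + α₃) ∪ U₀.image (· + (α₃ + e₁))))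
    (h23 : Disjoint (U₁.image (· + α₂) ∪ U₁.image (· + (α₂ + e₀))) (U₀.image (· + α₃) ∪ U₀.image (· + (α₃ + e₁))))
    (k12 : Disjoint (U₀.image (· + β₁) ∪ U₀.image (· + (β₁ + e₁))) (U₁.image (· + β₂) ∪ U₁.image (· + (β₂ + e₁))))
    (k13 : Disjoint (U₀.image (· + β₁) ∪ U₀.image (· + (β₁ + e₁))) (U₀.image (· + β₃) ∪ U₀.image (· + (β₃ + e₀))))
    (k23 : Disjoint (U₁.image (· + β₂) ∪ U₁.image (· + (β₂ + e₁))) (U₀.image (· + β₃) ∪ U₀.image (· + (β₃ + e₀))))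
    (hrel₁ : β₁ - β₂ = α₁ - α₂) (hrel₂ : β₃ - β₂ = α₃ - α₂ + e₁ - e₀ + c₀)
    (hper₀ : (U₀ ∪ U₀.image (· + e₁)).image (· + c₀) = U₀ ∪ U₀.image (· + e₁))
    (hper₁ : (U₁ ∪ U₁.image (· + e₁)).image (· + c₀) = U₁ ∪ U₁.image (· + e₁))
    (hsub : U₁.image (· + y) ∪ U₁.image (· + (y + e₁)) ⊆ U₀ ∪ U₀.image (· + e₁)) :
    π e₀ = 0 ∨ π e₁ = 0 ∨ π e₁ = π e₀ ∨ π e₁ = -π e₀ := by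
  by_cases he₀ : π e₀ = 0
  · exact Or.inl he₀
  by_cases he₁ : π e₁ = 0
  · exact Or.inr (Or.inl he₁)
  right; right
  have hπc : π c₀ = 0 := (hker c₀).2 (Or.inr rfl)
  have h2c : c₀ + c₀ = 0 := by
    rcases (hker (c₀ + c₀)).1 (by rw [map_add, hπc, add_zero]) with h | h
    · exact h
    · exact absurd (add_eq_left.1 h) hc₀
  -- the uncovered set `E`
  set D := U₀ ∪ U₀.image (· + e₁) with hD
  set C := U₁.image (· + y) ∪ U₁.image (· + (y + e₁)) with hC
  set E := D \ C with hE
  have dD : Disjoint U₀ (U₀.image (· + e₁)) := hU₀e₁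
  have dC : Disjoint (U₁.image (· + y)) (U₁.image (· + (y + e₁))) := disjoint_shift hU₁e₁ y
  have cE : E.card = 4 := by
    rw [hE, card_sdiff_of_subset hsub, hD, card_pair_union dD, hC, card_two_translates dC]; omega
  have hCper : C.image (· + c₀) = C := by
    have e : C = (U₁ ∪ U₁.image (· + e₁)).image (· + y) := by
      rw [hC, image_union, image_add_image, add_comm e₁ y]
    rw [e, image_add_image, add_comm y c₀, ← image_add_image, hper₁]
  have hEper : E.image (· + c₀) = E := by
    apply eq_of_subset_of_card_le _ (by rw [card_image_of_injective _ (add_left_injective c₀)])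
    intro x hx
    obtain ⟨z, hz, rfl⟩ := mem_image.1 hx
    obtain ⟨hzD, hzC⟩ := mem_sdiff.1 hz
    refine mem_sdiff.2 ⟨by rw [← hper₀]; exact mem_image_of_mem _ hzD, fun h => hzC ?_⟩
    have : z + c₀ + c₀ ∈ C := by rw [← hCper]; exact mem_image_of_mem _ h
    rwa [add_assoc, h2c, add_zero] at this
  obtain ⟨p, p', hpE, hp'E, hp'p, hp'pc, hEeq, hEdisj⟩ := periodic_card_four hc₀ h2c hEper cE
  have hne₁ : p ≠ p + c₀ := fun h => hc₀ (left_eq_add.1 h)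
  have hne₂ : p' ≠ p' + c₀ := fun h => hc₀ (left_eq_add.1 h)
  -- the character sum over `E`
  have key : ∀ χ : AddChar B ℂ, 2 * (χ (π p) + χ (π p')) =
      (1 + χ.compAddMonoidHom π e₁) *
        ((∑ x ∈ U₀, χ.compAddMonoidHom π x) - χ.compAddMonoidHom π y * ∑ x ∈ U₁, χ.compAddMonoidHom π x) := by
    intro χ
    set ψ := χ.compAddMonoidHom π with hψdef
    have hψc : ψ c₀ = 1 := by rw [hψdef, AddChar.compAddMonoidHom_apply, hπc, AddChar.map_zero_eq_one]
    have S0 : (∑ x ∈ E, ψ x) + ∑ x ∈ C, ψ x = ∑ x ∈ D, ψ x := sum_sdiff hsub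
    rw [hEeq, sum_union hEdisj, sum_pair hne₁, sum_pair hne₂, hC, charsum_two_translates ψ dC, hD,
      charsum_pair_union ψ dD, AddChar.map_add_eq_mul, AddChar.map_add_eq_mul, hψc,
      AddChar.map_add_eq_mul] at S0
    have e1 : χ (π p) = ψ p := by rw [hψdef, AddChar.compAddMonoidHom_apply]
    have e2 : χ (π p') = ψ p' := by rw [hψdef, AddChar.compAddMonoidHom_apply]
    rw [e1, e2]
    linear_combination S0
  -- hypotheses of the `±` lemma
  have hPP : π p ≠ π p' := by
    intro h
    rcases (hker (p' - p)).1 (by rw [map_sub, h, sub_self]) with h' | h'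
    · exact hp'p (sub_eq_zero.1 h')
    · exact hp'pc (by rw [← h', add_sub_cancel])
  have hinv : ∀ χ : AddChar B ℂ, (χ (π p) + χ (π p')) * ((1 - χ (π e₁ - π e₀)) * (1 - χ (π e₁ + π e₀))) = 0 := by
    intro χ
    obtain ⟨HY, HQ⟩ := n1_charsum_vanish π hπ hπc hU₀e₀ hU₀e₁ hU₁e₀ hU₁e₁ hA h12 h13 h23 k12 k13 k23 hrel₁ hrel₂ χ
    have eu : χ (π e₁ - π e₀) = χ.compAddMonoidHom π (e₁ - e₀) := by
      rw [AddChar.compAddMonoidHom_apply, map_sub π]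
    have ev : χ (π e₁ + π e₀) = χ.compAddMonoidHom π (e₁ + e₀) := by
      rw [AddChar.compAddMonoidHom_apply, map_add π]
    rw [eu, ev]
    have h2 : (2 : ℂ) ≠ 0 := two_ne_zero
    have := key χ
    have h3 : 2 * ((χ (π p) + χ (π p')) * ((1 - χ.compAddMonoidHom π (e₁ - e₀)) *
        (1 - χ.compAddMonoidHom π (e₁ + e₀)))) = 0 := by
      rw [← mul_assoc, this]
      linear_combination (1 + χ.compAddMonoidHom π e₁) * HY
        - (1 + χ.compAddMonoidHom π e₁) * χ.compAddMonoidHom π y * HQ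
    exact (mul_eq_zero.1 h3).resolve_left h2
  have hpar : ∀ χ : AddChar B ℂ, χ (π e₁) = -1 → χ (π p) + χ (π p') = 0 := by
    intro χ hχ
    have := key χ
    rw [AddChar.compAddMonoidHom_apply, hχ, add_neg_cancel, zero_mul] at this
    exact (mul_eq_zero.1 this).resolve_left two_ne_zero
  rcases eq_or_eq_neg_of_two_point hB hPP he₀ he₁ hinv hpar with h | h
  · exact Or.inl h
  · exact Or.inr h

end N1Dichotomy

end Summit.MatrixMultiplication.OmegaCensus
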